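import Literature.Analysis.UnboundedOperators.LinearizedBoltzmannQuarticWeightAction
import Literature.Analysis.UnboundedOperators.LinearizedBoltzmannChapmanEnskogInverse
import HarnessLib

/-!
# Weighted absorption for Grad's integral equation with the quartic weight (`ℝ³`)

Sibling proof file of `LinearizedBoltzmannWeightedAbsorption` (Gaussian weights), for the truncated quartic
weight `W = max ((1 + |·|²)², e^{|·|²/4}/N)`. For a solution `ψ` of Grad's integral equation
`ν ψ = ∫∫ B (ψ' + ψ_*' - ψ_*) dω dM_* - g` of the linearised hard-sphere operator of `ℝ³` dominated by
`|ψ| ≤ m W` we prove: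

* `lintegral_gain_fst_enorm_le_of_quarticWeight`, `abs_kernelAction_le_of_quarticWeight` — the gain pieces
  and the kernel action under the domination (`lintegral_gain_fst_quarticWeight_le` for the polynomial part,
  the Gaussian-weight gain bound for the truncation part, exchange symmetry `K₂'' = K₂'`, Cauchy–Schwarz for
  the loss piece);
* `abs_le_threeQuarter_weight_add_of_fixedPoint` — the one-step improvement
  `|ψ(y)| ≤ (3/4) m W(y) + C₂ (‖ψ‖_{L²(M)} + ‖g‖_∞)` at every large enough speed, using the SHARP
  `ν(y) ≥ π|y|`: the leading gain term is `(2/3)(1 + |y|⁻²) m W ≤ (17/24) m W` and the two lower-order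
  gain terms are `≤ m W/48` each.

This is the engine of the polynomial a-priori estimate of `LinearizedBoltzmannPolynomialInverse`.
No new definitions are introduced.
-/

open MeasureTheory Metric Real Set Filter Topology ProbabilityTheory Module
open scoped InnerProductSpace ENNReal

namespace Literature.Analysis.UnboundedOperators

noncomputable section

open Literature.MathematicalPhysics.KineticTheory (collide sphereMeasure hardSphereKernel
  lintegral_lintegral_hardSphere_gain_exchange)
open Literature.Analysis.FluidPDE

/-! ### The gain integral and the kernel action under the truncated quartic weight -/

/-- Measurability of the quartic gain integrand `(v_*, ω) ↦ ((v - v_*)·ω)₊ M(v_*) (1 + |v'|²)²`. [folklore] -/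
theorem measurable_kernel_mul_globalMaxwellian_mul_quartic_collide (v : EuclideanSpace ℝ (Fin 3)) :
    Measurable fun p : EuclideanSpace ℝ (Fin 3) × sphere (0 : EuclideanSpace ℝ (Fin 3)) 1 =>
      ENNReal.ofReal (hardSphereKernel (v, p.1) p.2 * globalMaxwellian p.1) *
        ENNReal.ofReal ((1 + ‖(collide p.2 (v, p.1)).1‖ ^ 2) ^ 2) := by
  have h1 : Continuous fun p : EuclideanSpace ℝ (Fin 3) × sphere (0 : EuclideanSpace ℝ (Fin 3)) 1 =>
      hardSphereKernel (v, p.1) p.2 * globalMaxwellian p.1 := by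
    refine Continuous.mul ?_ (continuous_globalMaxwellian.comp continuous_fst)
    unfold hardSphereKernel; fun_prop
  have h2 : Continuous fun p : EuclideanSpace ℝ (Fin 3) × sphere (0 : EuclideanSpace ℝ (Fin 3)) 1 =>
      (1 + ‖(collide p.2 (v, p.1)).1‖ ^ 2) ^ 2 := by
    unfold collide; fun_prop
  exact h1.measurable.ennreal_ofReal.mul h2.measurable.ennreal_ofReal

/-- **The gain integral under the truncated quartic weight** `W = max ((1 + |·|²)², e^{|·|²/4}/N)`: if
`|ψ| ≤ m W` then `∫∫ ((v - v_*)·ω)₊ M(v_*) |ψ(v')| ≤ m (π(1+|v|²)³/(3|v|) + K_Φ (1+|v|²)² + N⁻¹ K' e^{|v|²/4}/|v|)`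
(`lintegral_gain_fst_quarticWeight_le` for the polynomial part, the Gaussian-weight gain bound with
constant `K'` for the truncation part). [folklore] -/
theorem lintegral_gain_fst_enorm_le_of_quarticWeight {ψ : EuclideanSpace ℝ (Fin 3) → ℝ} {N m K' : ℝ}
    (hN : 0 < N) (hm : 0 ≤ m) (hK' : 0 ≤ K')
    (hdom : ∀ y, |ψ y| ≤ m * max ((1 + ‖y‖ ^ 2) ^ 2) (Real.exp ((1 / 4 : ℝ) * ‖y‖ ^ 2) / N))
    {v : EuclideanSpace ℝ (Fin 3)} (hv : v ≠ 0)
    (hK'v : ∫⁻ w, ∫⁻ ω, ENNReal.ofReal (hardSphereKernel (v, w) ω * globalMaxwellian w) *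
        ENNReal.ofReal (Real.exp ((1 / 4 : ℝ) * ‖(collide ω (v, w)).1‖ ^ 2)) ∂sphereMeasure ≤
      ENNReal.ofReal (K' * Real.exp ((1 / 4 : ℝ) * ‖v‖ ^ 2) / ‖v‖)) :
    ∫⁻ w, ∫⁻ ω, ENNReal.ofReal (hardSphereKernel (v, w) ω * globalMaxwellian w) *
        ‖ψ (collide ω (v, w)).1‖ₑ ∂sphereMeasure ≤
      ENNReal.ofReal (m * (Real.pi * (1 + ‖v‖ ^ 2) ^ 3 / (3 * ‖v‖) +
        3 * (sphereMeasure : Measure (sphere (0 : EuclideanSpace ℝ (Fin 3)) 1)).real univ *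
          (∫ w, (1 + ‖w‖) ^ 5 ∂stdGaussian (EuclideanSpace ℝ (Fin 3))) * (1 + ‖v‖ ^ 2) ^ 2 +
        N⁻¹ * (K' * Real.exp ((1 / 4 : ℝ) * ‖v‖ ^ 2) / ‖v‖))) := by
  haveI := isFiniteMeasure_sphereMeasure (E := EuclideanSpace ℝ (Fin 3))
  set Q : ℝ := Real.pi * (1 + ‖v‖ ^ 2) ^ 3 / (3 * ‖v‖) +
    3 * (sphereMeasure : Measure (sphere (0 : EuclideanSpace ℝ (Fin 3)) 1)).real univ *
      (∫ w, (1 + ‖w‖) ^ 5 ∂stdGaussian (EuclideanSpace ℝ (Fin 3))) * (1 + ‖v‖ ^ 2) ^ 2 with hQ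
  have hS0 : 0 ≤ (sphereMeasure : Measure (sphere (0 : EuclideanSpace ℝ (Fin 3)) 1)).real univ := measureReal_nonneg
  have hm₅0 : 0 ≤ ∫ w, (1 + ‖w‖) ^ 5 ∂stdGaussian (EuclideanSpace ℝ (Fin 3)) := integral_nonneg fun w => by positivity
  have hQ0 : 0 ≤ Q := by rw [hQ]; positivity
  set F₁ : EuclideanSpace ℝ (Fin 3) → sphere (0 : EuclideanSpace ℝ (Fin 3)) 1 → ℝ≥0∞ := fun w ω =>
    ENNReal.ofReal (hardSphereKernel (v, w) ω * globalMaxwellian w) *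
      ENNReal.ofReal ((1 + ‖(collide ω (v, w)).1‖ ^ 2) ^ 2) with hF₁
  set F₂ : EuclideanSpace ℝ (Fin 3) → sphere (0 : EuclideanSpace ℝ (Fin 3)) 1 → ℝ≥0∞ := fun w ω =>
    ENNReal.ofReal (hardSphereKernel (v, w) ω * globalMaxwellian w) *
      ENNReal.ofReal (Real.exp ((1 / 4 : ℝ) * ‖(collide ω (v, w)).1‖ ^ 2)) with hF₂
  have hF₁m : Measurable (Function.uncurry F₁) := measurable_kernel_mul_globalMaxwellian_mul_quartic_collide v
  -- pointwise domination
  have hpt : ∀ w ω, ENNReal.ofReal (hardSphereKernel (v, w) ω * globalMaxwellian w) *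
      ‖ψ (collide ω (v, w)).1‖ₑ ≤ ENNReal.ofReal m * (F₁ w ω + ENNReal.ofReal N⁻¹ * F₂ w ω) := by
    intro w ω
    set y := (collide ω (v, w)).1 with hy
    have hmax : max ((1 + ‖y‖ ^ 2) ^ 2) (Real.exp ((1 / 4 : ℝ) * ‖y‖ ^ 2) / N) ≤
        (1 + ‖y‖ ^ 2) ^ 2 + N⁻¹ * Real.exp ((1 / 4 : ℝ) * ‖y‖ ^ 2) := by
      refine max_le (le_add_of_nonneg_right (by positivity)) ?_
      rw [div_eq_inv_mul]
      exact le_add_of_nonneg_left (sq_nonneg _)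
    have h1 : ‖ψ y‖ₑ ≤ ENNReal.ofReal (m * ((1 + ‖y‖ ^ 2) ^ 2 + N⁻¹ * Real.exp ((1 / 4 : ℝ) * ‖y‖ ^ 2))) := by
      rw [Real.enorm_eq_ofReal_abs]
      exact ENNReal.ofReal_le_ofReal ((hdom y).trans (mul_le_mul_of_nonneg_left hmax hm))
    calc ENNReal.ofReal (hardSphereKernel (v, w) ω * globalMaxwellian w) * ‖ψ y‖ₑ
        ≤ ENNReal.ofReal (hardSphereKernel (v, w) ω * globalMaxwellian w) *
            ENNReal.ofReal (m * ((1 + ‖y‖ ^ 2) ^ 2 + N⁻¹ * Real.exp ((1 / 4 : ℝ) * ‖y‖ ^ 2))) :=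
          mul_le_mul' le_rfl h1
      _ = ENNReal.ofReal m * (F₁ w ω + ENNReal.ofReal N⁻¹ * F₂ w ω) := by
          rw [hF₁, hF₂]
          dsimp only
          rw [← hy, ENNReal.ofReal_mul hm, ENNReal.ofReal_add (sq_nonneg _) (by positivity),
            ENNReal.ofReal_mul (inv_nonneg.2 hN.le)]
          ring
  have hinner : ∀ w, ∫⁻ ω, ENNReal.ofReal m * (F₁ w ω + ENNReal.ofReal N⁻¹ * F₂ w ω) ∂sphereMeasure =
      ENNReal.ofReal m * ((∫⁻ ω, F₁ w ω ∂sphereMeasure) + ENNReal.ofReal N⁻¹ * ∫⁻ ω, F₂ w ω ∂sphereMeasure) := by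
    intro w
    have hm1 : Measurable fun ω => F₁ w ω := hF₁m.of_uncurry_left
    rw [lintegral_const_mul' _ _ ENNReal.ofReal_ne_top, lintegral_add_left hm1,
      lintegral_const_mul' _ _ ENNReal.ofReal_ne_top]
  have hout : ∫⁻ w, ENNReal.ofReal m * ((∫⁻ ω, F₁ w ω ∂sphereMeasure) +
      ENNReal.ofReal N⁻¹ * ∫⁻ ω, F₂ w ω ∂sphereMeasure) =
      ENNReal.ofReal m * ((∫⁻ w, ∫⁻ ω, F₁ w ω ∂sphereMeasure) +
        ENNReal.ofReal N⁻¹ * ∫⁻ w, ∫⁻ ω, F₂ w ω ∂sphereMeasure) := by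
    have hm1 : Measurable fun w => ∫⁻ ω, F₁ w ω ∂(sphereMeasure : Measure (sphere (0 : EuclideanSpace ℝ (Fin 3)) 1)) :=
      hF₁m.lintegral_prod_right'
    rw [lintegral_const_mul' _ _ ENNReal.ofReal_ne_top, lintegral_add_left hm1,
      lintegral_const_mul' _ _ ENNReal.ofReal_ne_top]
  have hF₁le : ∫⁻ w, ∫⁻ ω, F₁ w ω ∂sphereMeasure ≤ ENNReal.ofReal Q := by
    have h := lintegral_gain_fst_quarticWeight_le hv
    rw [← hQ] at h
    exact h
  calc ∫⁻ w, ∫⁻ ω, ENNReal.ofReal (hardSphereKernel (v, w) ω * globalMaxwellian w) *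
          ‖ψ (collide ω (v, w)).1‖ₑ ∂sphereMeasure
      ≤ ∫⁻ w, ∫⁻ ω, ENNReal.ofReal m * (F₁ w ω + ENNReal.ofReal N⁻¹ * F₂ w ω) ∂sphereMeasure :=
        lintegral_mono fun w => lintegral_mono fun ω => hpt w ω
    _ = ENNReal.ofReal m * ((∫⁻ w, ∫⁻ ω, F₁ w ω ∂sphereMeasure) +
          ENNReal.ofReal N⁻¹ * ∫⁻ w, ∫⁻ ω, F₂ w ω ∂sphereMeasure) := by
        rw [lintegral_congr hinner, hout]
    _ ≤ ENNReal.ofReal m * (ENNReal.ofReal Q +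
          ENNReal.ofReal N⁻¹ * ENNReal.ofReal (K' * Real.exp ((1 / 4 : ℝ) * ‖v‖ ^ 2) / ‖v‖)) :=
        mul_le_mul' le_rfl (add_le_add hF₁le (mul_le_mul' le_rfl hK'v))
    _ = ENNReal.ofReal (m * (Q + N⁻¹ * (K' * Real.exp ((1 / 4 : ℝ) * ‖v‖ ^ 2) / ‖v‖))) := by
        rw [← ENNReal.ofReal_mul (inv_nonneg.2 hN.le), ← ENNReal.ofReal_add hQ0 (by positivity),
          ← ENNReal.ofReal_mul hm]
    _ = _ := by rw [hQ, add_assoc]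

/-- **The kernel action under the truncated quartic weight**: if `|ψ| ≤ m W`,
`W = max ((1 + |·|²)², e^{|·|²/4}/N)`, and `‖ψ‖_{L²(M)} ≤ B`, then for `v ≠ 0`
`|∫∫ B (ψ' + ψ_*' - ψ_*)| ≤ 2 m (π(1+|v|²)³/(3|v|) + K_Φ(1+|v|²)² + N⁻¹K' e^{|v|²/4}/|v|) + σ(S²)(1 + |v|) m₂ B`.
[folklore] -/
theorem abs_kernelAction_le_of_quarticWeight {ψ : EuclideanSpace ℝ (Fin 3) → ℝ} (hψm : Measurable ψ)
    (hψ2 : MemLp ψ 2 (stdGaussian (EuclideanSpace ℝ (Fin 3)))) {N m K' B : ℝ}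
    (hN : 0 < N) (hm : 0 ≤ m) (hK' : 0 ≤ K')
    (hdom : ∀ y, |ψ y| ≤ m * max ((1 + ‖y‖ ^ 2) ^ 2) (Real.exp ((1 / 4 : ℝ) * ‖y‖ ^ 2) / N))
    (hB : (eLpNorm ψ 2 (stdGaussian (EuclideanSpace ℝ (Fin 3)))).toReal ≤ B)
    {v : EuclideanSpace ℝ (Fin 3)} (hv : v ≠ 0)
    (hK'v : ∫⁻ w, ∫⁻ ω, ENNReal.ofReal (hardSphereKernel (v, w) ω * globalMaxwellian w) *
        ENNReal.ofReal (Real.exp ((1 / 4 : ℝ) * ‖(collide ω (v, w)).1‖ ^ 2)) ∂sphereMeasure ≤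
      ENNReal.ofReal (K' * Real.exp ((1 / 4 : ℝ) * ‖v‖ ^ 2) / ‖v‖)) :
    |∫ w, ∫ ω, hardSphereKernel (v, w) ω * (ψ (collide ω (v, w)).1 + ψ (collide ω (v, w)).2 - ψ w)
        ∂sphereMeasure ∂stdGaussian (EuclideanSpace ℝ (Fin 3))| ≤
      2 * (m * (Real.pi * (1 + ‖v‖ ^ 2) ^ 3 / (3 * ‖v‖) +
        3 * (sphereMeasure : Measure (sphere (0 : EuclideanSpace ℝ (Fin 3)) 1)).real univ *
          (∫ w, (1 + ‖w‖) ^ 5 ∂stdGaussian (EuclideanSpace ℝ (Fin 3))) * (1 + ‖v‖ ^ 2) ^ 2 +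
        N⁻¹ * (K' * Real.exp ((1 / 4 : ℝ) * ‖v‖ ^ 2) / ‖v‖))) +
        (sphereMeasure : Measure (sphere (0 : EuclideanSpace ℝ (Fin 3)) 1)).real univ * (1 + ‖v‖) *
          (((∫⁻ w, ENNReal.ofReal ((1 + ‖w‖) ^ 2) ∂stdGaussian (EuclideanSpace ℝ (Fin 3))) ^ (1 / 2 : ℝ)).toReal * B) := by
  haveI := isFiniteMeasure_sphereMeasure (E := EuclideanSpace ℝ (Fin 3))
  have hS0 : 0 ≤ (sphereMeasure : Measure (sphere (0 : EuclideanSpace ℝ (Fin 3)) 1)).real univ := measureReal_nonneg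
  have hm₅0 : 0 ≤ ∫ w, (1 + ‖w‖) ^ 5 ∂stdGaussian (EuclideanSpace ℝ (Fin 3)) := integral_nonneg fun w => by positivity
  set X : ℝ := m * (Real.pi * (1 + ‖v‖ ^ 2) ^ 3 / (3 * ‖v‖) +
        3 * (sphereMeasure : Measure (sphere (0 : EuclideanSpace ℝ (Fin 3)) 1)).real univ *
          (∫ w, (1 + ‖w‖) ^ 5 ∂stdGaussian (EuclideanSpace ℝ (Fin 3))) * (1 + ‖v‖ ^ 2) ^ 2 +
        N⁻¹ * (K' * Real.exp ((1 / 4 : ℝ) * ‖v‖ ^ 2) / ‖v‖)) with hX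
  have hX0 : 0 ≤ X := by rw [hX]; positivity
  set M2 : ℝ≥0∞ := (∫⁻ w, ENNReal.ofReal ((1 + ‖w‖) ^ 2) ∂stdGaussian (EuclideanSpace ℝ (Fin 3))) ^ (1 / 2 : ℝ)
    with hM2
  have hM2t : M2 ≠ ∞ := by
    refine ENNReal.rpow_ne_top_of_nonneg (by norm_num) ?_
    exact ((integrable_one_add_norm_pow_stdGaussian (E := EuclideanSpace ℝ (Fin 3)) 2).lintegral_lt_top).ne
  set S : ℝ := (sphereMeasure : Measure (sphere (0 : EuclideanSpace ℝ (Fin 3)) 1)).real univ with hS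
  set Nψ : ℝ≥0∞ := eLpNorm ψ 2 (stdGaussian (EuclideanSpace ℝ (Fin 3))) with hNψ
  have hNt : Nψ ≠ ∞ := hψ2.eLpNorm_ne_top
  have hc1 : Measurable fun p : EuclideanSpace ℝ (Fin 3) × sphere (0 : EuclideanSpace ℝ (Fin 3)) 1 =>
      (collide p.2 (v, p.1)).1 := by
    have : Continuous fun p : EuclideanSpace ℝ (Fin 3) × sphere (0 : EuclideanSpace ℝ (Fin 3)) 1 =>
        (collide p.2 (v, p.1)).1 := by unfold collide; fun_prop
    exact this.measurable
  have hc2 : Measurable fun p : EuclideanSpace ℝ (Fin 3) × sphere (0 : EuclideanSpace ℝ (Fin 3)) 1 =>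
      (collide p.2 (v, p.1)).2 := by
    have : Continuous fun p : EuclideanSpace ℝ (Fin 3) × sphere (0 : EuclideanSpace ℝ (Fin 3)) 1 =>
        (collide p.2 (v, p.1)).2 := by unfold collide; fun_prop
    exact this.measurable
  have I1 : ∫⁻ w, ∫⁻ ω, ENNReal.ofReal (hardSphereKernel (v, w) ω) * ‖ψ (collide ω (v, w)).1‖ₑ
      ∂sphereMeasure ∂stdGaussian (EuclideanSpace ℝ (Fin 3)) ≤ ENNReal.ofReal X := by
    rw [lintegral_stdGaussian_kernel_eq_volume (U := fun p => ‖ψ (collide p.2 (v, p.1)).1‖ₑ)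
      ((hψm.comp hc1).enorm) v]
    exact lintegral_gain_fst_enorm_le_of_quarticWeight hN hm hK' hdom hv hK'v
  have I2 : ∫⁻ w, ∫⁻ ω, ENNReal.ofReal (hardSphereKernel (v, w) ω) * ‖ψ (collide ω (v, w)).2‖ₑ
      ∂sphereMeasure ∂stdGaussian (EuclideanSpace ℝ (Fin 3)) ≤ ENNReal.ofReal X := by
    rw [lintegral_stdGaussian_kernel_eq_volume (U := fun p => ‖ψ (collide p.2 (v, p.1)).2‖ₑ)
      ((hψm.comp hc2).enorm) v,
      lintegral_lintegral_hardSphere_gain_exchange v globalMaxwellian volume hψm.enorm]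
    exact lintegral_gain_fst_enorm_le_of_quarticWeight hN hm hK' hdom hv hK'v
  have I3 : ∫⁻ w, ∫⁻ ω, ENNReal.ofReal (hardSphereKernel (v, w) ω) * ‖ψ w‖ₑ
      ∂sphereMeasure ∂stdGaussian (EuclideanSpace ℝ (Fin 3)) ≤ ENNReal.ofReal (S * (1 + ‖v‖)) * (M2 * Nψ) :=
    lintegral_loss_enorm_le hψm v
  have htot := (enorm_kernelAction_le_add hψm v).trans (add_le_add (add_le_add I1 I2) I3)
  have hne3 : ENNReal.ofReal (S * (1 + ‖v‖)) * (M2 * Nψ) ≠ ∞ :=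
    ENNReal.mul_ne_top ENNReal.ofReal_ne_top (ENNReal.mul_ne_top hM2t hNt)
  have hfin : ENNReal.ofReal X + ENNReal.ofReal X + ENNReal.ofReal (S * (1 + ‖v‖)) * (M2 * Nψ) ≠ ∞ :=
    ENNReal.add_ne_top.2 ⟨ENNReal.add_ne_top.2 ⟨ENNReal.ofReal_ne_top, ENNReal.ofReal_ne_top⟩, hne3⟩
  have habs : |∫ w, ∫ ω, hardSphereKernel (v, w) ω *
        (ψ (collide ω (v, w)).1 + ψ (collide ω (v, w)).2 - ψ w) ∂sphereMeasure
          ∂stdGaussian (EuclideanSpace ℝ (Fin 3))| = (‖∫ w, ∫ ω, hardSphereKernel (v, w) ω *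
        (ψ (collide ω (v, w)).1 + ψ (collide ω (v, w)).2 - ψ w) ∂sphereMeasure
          ∂stdGaussian (EuclideanSpace ℝ (Fin 3))‖ₑ).toReal := by
    rw [Real.enorm_eq_ofReal_abs, ENNReal.toReal_ofReal (abs_nonneg _)]
  rw [habs]
  refine (ENNReal.toReal_mono hfin htot).trans ?_
  rw [ENNReal.toReal_add (ENNReal.add_ne_top.2 ⟨ENNReal.ofReal_ne_top, ENNReal.ofReal_ne_top⟩) hne3,
    ENNReal.toReal_add ENNReal.ofReal_ne_top ENNReal.ofReal_ne_top, ENNReal.toReal_ofReal hX0,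
    ENNReal.toReal_mul, ENNReal.toReal_mul, ENNReal.toReal_ofReal (by positivity)]
  have h1 : M2.toReal * Nψ.toReal ≤ M2.toReal * B := mul_le_mul_of_nonneg_left hB ENNReal.toReal_nonneg
  have h2 := mul_le_mul_of_nonneg_left h1 (by positivity : 0 ≤ S * (1 + ‖v‖))
  linarith

/-! ### The absorption step and the polynomial a-priori estimate -/

/-- **Off-ball absorption for the quartic weight.** Under Grad's integral equation at `y`, the
domination `|ψ| ≤ m W` (`W = max ((1 + |·|²)², e^{|·|²/4}/N)`) improves to
`|ψ(y)| ≤ (3/4) m W(y) + C₂ (B + b)` as soon as `|y| ≥ 4`, `π |y| ≥ 96 K_Φ` and `π |y|² ≥ 96 K'`: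
the sharp `ν(y) ≥ π|y|` turns the leading gain term `2 m π (1+|y|²)³/(3|y|)` into
`(2/3)(1 + |y|⁻²) m (1+|y|²)² ≤ (17/24) m W`, and the two lower-order gain terms are `≤ m W/48` each.
[folklore] -/
theorem abs_le_threeQuarter_weight_add_of_fixedPoint {ψ g : EuclideanSpace ℝ (Fin 3) → ℝ} (hψm : Measurable ψ)
    (hψ2 : MemLp ψ 2 (stdGaussian (EuclideanSpace ℝ (Fin 3)))) {N m K' B b ν₀ : ℝ}
    (hN : 0 < N) (hm : 0 ≤ m) (hK' : 0 ≤ K') (hB0 : 0 ≤ B) (hb0 : 0 ≤ b) (hν₀ : 0 < ν₀)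
    (hdom : ∀ y, |ψ y| ≤ m * max ((1 + ‖y‖ ^ 2) ^ 2) (Real.exp ((1 / 4 : ℝ) * ‖y‖ ^ 2) / N))
    (hB : (eLpNorm ψ 2 (stdGaussian (EuclideanSpace ℝ (Fin 3)))).toReal ≤ B)
    {y : EuclideanSpace ℝ (Fin 3)} (hy1 : 4 ≤ ‖y‖)
    (hy2 : 96 * (3 * (sphereMeasure : Measure (sphere (0 : EuclideanSpace ℝ (Fin 3)) 1)).real univ *
      (∫ w, (1 + ‖w‖) ^ 5 ∂stdGaussian (EuclideanSpace ℝ (Fin 3)))) ≤ Real.pi * ‖y‖)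
    (hy3 : 96 * K' ≤ Real.pi * ‖y‖ ^ 2)
    (hνy : ν₀ ≤ collisionFrequency y) (hgb : |g y| ≤ b)
    (hK'v : ∫⁻ w, ∫⁻ ω, ENNReal.ofReal (hardSphereKernel (y, w) ω * globalMaxwellian w) *
        ENNReal.ofReal (Real.exp ((1 / 4 : ℝ) * ‖(collide ω (y, w)).1‖ ^ 2)) ∂sphereMeasure ≤
      ENNReal.ofReal (K' * Real.exp ((1 / 4 : ℝ) * ‖y‖ ^ 2) / ‖y‖))
    (hfix : collisionFrequency y * ψ y =
      (∫ w, ∫ ω, hardSphereKernel (y, w) ω * (ψ (collide ω (y, w)).1 + ψ (collide ω (y, w)).2 - ψ w)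
        ∂sphereMeasure ∂stdGaussian (EuclideanSpace ℝ (Fin 3))) - g y) :
    |ψ y| ≤ 3 / 4 * m * max ((1 + ‖y‖ ^ 2) ^ 2) (Real.exp ((1 / 4 : ℝ) * ‖y‖ ^ 2) / N) +
      ((sphereMeasure : Measure (sphere (0 : EuclideanSpace ℝ (Fin 3)) 1)).real univ *
        (((∫⁻ w, ENNReal.ofReal ((1 + ‖w‖) ^ 2) ∂stdGaussian (EuclideanSpace ℝ (Fin 3))) ^ (1 / 2 : ℝ)).toReal) *
          (1 / ν₀ + 1 / Real.pi) + 1 / ν₀) * (B + b) := by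
  set S : ℝ := (sphereMeasure : Measure (sphere (0 : EuclideanSpace ℝ (Fin 3)) 1)).real univ with hS
  have hS0 : 0 ≤ S := measureReal_nonneg
  set m₂ : ℝ := (((∫⁻ w, ENNReal.ofReal ((1 + ‖w‖) ^ 2) ∂stdGaussian (EuclideanSpace ℝ (Fin 3))) ^
    (1 / 2 : ℝ))).toReal with hm₂
  have hm₂0 : 0 ≤ m₂ := ENNReal.toReal_nonneg
  set m₅ : ℝ := ∫ w, (1 + ‖w‖) ^ 5 ∂stdGaussian (EuclideanSpace ℝ (Fin 3)) with hm₅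
  have hm₅0 : 0 ≤ m₅ := integral_nonneg fun w => by positivity
  set KΦ : ℝ := 3 * S * m₅ with hKΦ
  have hKΦ0 : 0 ≤ KΦ := by rw [hKΦ]; exact mul_nonneg (mul_nonneg (by norm_num) hS0) hm₅0
  set P : ℝ := 1 + ‖y‖ ^ 2 with hP
  set E₄ : ℝ := Real.exp ((1 / 4 : ℝ) * ‖y‖ ^ 2) / N with hE₄
  have hE₄0 : 0 ≤ E₄ := by rw [hE₄]; positivity
  set W : ℝ := max (P ^ 2) E₄ with hW
  have hPW : P ^ 2 ≤ W := le_max_left _ _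
  have hEW : E₄ ≤ W := le_max_right _ _
  have hWpos : 0 < W := lt_max_of_lt_left (by rw [hP]; positivity)
  have hyn : 0 < ‖y‖ := by linarith
  have hy0 : y ≠ 0 := norm_pos_iff.1 hyn
  have hνπ : Real.pi * ‖y‖ ≤ collisionFrequency y := pi_mul_norm_le_collisionFrequency y
  have hν : 0 < collisionFrequency y := hν₀.trans_le hνy
  have hKψ := abs_kernelAction_le_of_quarticWeight hψm hψ2 hN hm hK' hdom hB hy0 hK'v
  rw [← hS, ← hm₅, ← hm₂, ← hP] at hKψ
  set Kψ := ∫ w, ∫ ω, hardSphereKernel (y, w) ω * (ψ (collide ω (y, w)).1 + ψ (collide ω (y, w)).2 - ψ w)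
    ∂sphereMeasure ∂stdGaussian (EuclideanSpace ℝ (Fin 3)) with hKψdef
  -- `|ψ y| ν ≤ |Kψ| + b`
  have hψy : |ψ y| * collisionFrequency y ≤ |Kψ| + b := by
    have : ψ y * collisionFrequency y = Kψ - g y := by rw [mul_comm]; exact hfix
    rw [← abs_of_pos hν, ← abs_mul, this]
    exact (abs_sub _ _).trans (add_le_add le_rfl hgb)
  -- the three gain terms, each compared with `m W ν`
  have hg1 : 2 * (m * (Real.pi * P ^ 3 / (3 * ‖y‖))) ≤ 17 / 24 * m * W * collisionFrequency y := by
    -- `2 π P³/(3|y|) ≤ (17/24) P² (π |y|)` iff `16 P ≤ 17 |y|²`, true for `|y| ≥ 4`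
    have h16 : 16 * P ≤ 17 * ‖y‖ ^ 2 := by rw [hP]; nlinarith
    have hmW : 0 ≤ m * P ^ 2 := mul_nonneg hm (sq_nonneg _)
    calc 2 * (m * (Real.pi * P ^ 3 / (3 * ‖y‖))) = (m * P ^ 2) * (2 * Real.pi * P / (3 * ‖y‖)) := by
          field_simp
      _ ≤ (m * P ^ 2) * (17 / 24 * (Real.pi * ‖y‖)) := by
          refine mul_le_mul_of_nonneg_left ?_ hmW
          rw [div_le_iff₀ (mul_pos (by norm_num) hyn)]
          nlinarith [Real.pi_pos, mul_le_mul_of_nonneg_left h16 Real.pi_pos.le]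
      _ ≤ (m * W) * (17 / 24 * collisionFrequency y) := by
          refine mul_le_mul (mul_le_mul_of_nonneg_left hPW hm) (mul_le_mul_of_nonneg_left hνπ (by norm_num))
            (by positivity) (mul_nonneg hm hWpos.le)
      _ = 17 / 24 * m * W * collisionFrequency y := by ring
  have hg2 : 2 * (m * (KΦ * P ^ 2)) ≤ 1 / 48 * m * W * collisionFrequency y := by
    -- `2 KΦ ≤ (1/48) π |y|` by `hy2`
    have hmW : 0 ≤ m * P ^ 2 := mul_nonneg hm (sq_nonneg _)
    calc 2 * (m * (KΦ * P ^ 2)) = (m * P ^ 2) * (2 * KΦ) := by ring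
      _ ≤ (m * P ^ 2) * (1 / 48 * (Real.pi * ‖y‖)) := mul_le_mul_of_nonneg_left (by rw [hKΦ]; linarith) hmW
      _ ≤ (m * W) * (1 / 48 * collisionFrequency y) := by
          refine mul_le_mul (mul_le_mul_of_nonneg_left hPW hm) (mul_le_mul_of_nonneg_left hνπ (by norm_num))
            (by positivity) (mul_nonneg hm hWpos.le)
      _ = 1 / 48 * m * W * collisionFrequency y := by ring
  have hg3 : 2 * (m * (N⁻¹ * (K' * Real.exp ((1 / 4 : ℝ) * ‖y‖ ^ 2) / ‖y‖))) ≤ 1 / 48 * m * W * collisionFrequency y := by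
    -- `2 K'/|y| ≤ (1/48) π |y|` by `hy3`
    have hmE : 0 ≤ m * E₄ := mul_nonneg hm hE₄0
    calc 2 * (m * (N⁻¹ * (K' * Real.exp ((1 / 4 : ℝ) * ‖y‖ ^ 2) / ‖y‖))) = (m * E₄) * (2 * K' / ‖y‖) := by
          rw [hE₄]; field_simp
      _ ≤ (m * E₄) * (1 / 48 * (Real.pi * ‖y‖)) := by
          refine mul_le_mul_of_nonneg_left ?_ hmE
          rw [div_le_iff₀ hyn]
          nlinarith
      _ ≤ (m * W) * (1 / 48 * collisionFrequency y) := by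
          refine mul_le_mul (mul_le_mul_of_nonneg_left hEW hm) (mul_le_mul_of_nonneg_left hνπ (by norm_num))
            (by positivity) (mul_nonneg hm hWpos.le)
      _ = 1 / 48 * m * W * collisionFrequency y := by ring
  -- loss and source parts
  have h1 : 1 ≤ collisionFrequency y / ν₀ := by rw [le_div_iff₀ hν₀, one_mul]; exact hνy
  have h2 : ‖y‖ ≤ collisionFrequency y / Real.pi := by
    rw [le_div_iff₀ Real.pi_pos, mul_comm]; exact hνπ
  have hrest : S * (1 + ‖y‖) * (m₂ * B) + b ≤ (S * m₂ * (1 / ν₀ + 1 / Real.pi) + 1 / ν₀) * (B + b) * collisionFrequency y := by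
    have hSmB : 0 ≤ S * m₂ * B := mul_nonneg (mul_nonneg hS0 hm₂0) hB0
    have hνq : 0 ≤ collisionFrequency y / ν₀ + collisionFrequency y / Real.pi :=
      add_nonneg (div_nonneg hν.le hν₀.le) (div_nonneg hν.le Real.pi_pos.le)
    have i1 : S * (1 + ‖y‖) * (m₂ * B) ≤ S * m₂ * B * (collisionFrequency y / ν₀ + collisionFrequency y / Real.pi) := by
      rw [show S * (1 + ‖y‖) * (m₂ * B) = S * m₂ * B * (1 + ‖y‖) by ring]
      exact mul_le_mul_of_nonneg_left (add_le_add h1 h2) hSmB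
    have i2 : b ≤ b * (collisionFrequency y / ν₀) := le_mul_of_one_le_right hb0 h1
    have i3 : 0 ≤ S * m₂ * b * (collisionFrequency y / ν₀ + collisionFrequency y / Real.pi) :=
      mul_nonneg (mul_nonneg (mul_nonneg hS0 hm₂0) hb0) hνq
    have i4 : 0 ≤ B * (collisionFrequency y / ν₀) := mul_nonneg hB0 (div_nonneg hν.le hν₀.le)
    have e : (S * m₂ * (1 / ν₀ + 1 / Real.pi) + 1 / ν₀) * (B + b) * collisionFrequency y =
        S * m₂ * B * (collisionFrequency y / ν₀ + collisionFrequency y / Real.pi) +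
          S * m₂ * b * (collisionFrequency y / ν₀ + collisionFrequency y / Real.pi) +
          B * (collisionFrequency y / ν₀) + b * (collisionFrequency y / ν₀) := by
      field_simp
      ring
    rw [e]
    linarith
  -- combine and divide by `ν`
  have htot : |ψ y| * collisionFrequency y ≤
      (3 / 4 * m * W + (S * m₂ * (1 / ν₀ + 1 / Real.pi) + 1 / ν₀) * (B + b)) * collisionFrequency y := by
    have e : (3 / 4 * m * W + (S * m₂ * (1 / ν₀ + 1 / Real.pi) + 1 / ν₀) * (B + b)) * collisionFrequency y =
        17 / 24 * m * W * collisionFrequency y + 1 / 48 * m * W * collisionFrequency y +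
          1 / 48 * m * W * collisionFrequency y +
          (S * m₂ * (1 / ν₀ + 1 / Real.pi) + 1 / ν₀) * (B + b) * collisionFrequency y := by ring
    rw [e]
    rw [← hKΦ] at hKψ
    linarith
  exact le_of_mul_le_mul_right htot hν


end

end Literature.Analysis.UnboundedOperators
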